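import Mathlib
import Summits.ValiantsHypothesis.ValiantsHypothesis.Theses.ValuativeGCT
import Summits.ValiantsHypothesis.ValiantsHypothesis.Theorems.ValuativeGCTValuativeBound
import Summits.ValiantsHypothesis.ValiantsHypothesis.Theorems.ValuativeGCTNoValuativeFlipOccurrence
import Literature.Computability.Complexity.OccurrenceObstructionsBIP
import Literature.Computability.Complexity.OccurrenceObstructionsDischarge
import Literature.Computability.AlgebraicComplexity.OrbitCoordinateRingProofs
import Literature.NumberTheory.DiophantineGeometry.SchurWeylPlethysmOrbitWeightsProofs
import Literature.NumberTheory.DiophantineGeometry.TensorWordModel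

/-!
# `NoValuativeFlip` (stmt-ValiantsHypothesis-12629): both sides of the inequality are monotone
# along the occurrence semigroup (quantitative semigroup property)

Route `ValuativeGCT`, support item `NoValuativeFlip` (the valuative no-go
`mult_λ* ℂ[Δ(X₀₀^(m-n) per_n)] ≤ dim T_U(λ)` beyond some polynomial padding `m ≥ n ^ c₀`; open,
`⇐ GCTMult.GctNoMultBarrier` stmt-0890, `¬ ⇒ DcPerSuperpolynomial ℂ`, files
`ValuativeGCTNoValuativeFlipReductions/Unconditional`). Its open content is a comparison of two
multiplicity functions of the weight `λ*` on Kadish–Landsberg shapes of growing length. This file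
records the one growth law both functions obey unconditionally — the MULTIPLICITY form of
Bürgisser–Ikenmeyer–Panova's semigroup property (J. AMS 32 (2019), Lemma 2.2, which is its
occurrence shadow `K(χ) > 0 ∧ K(μ) > 0 → K(χ + μ) > 0`):

* §1 for every form `f` and `m ≠ 0`: `mult_χ ℂ[Δ_m(f)] ≤ mult_(χ+μ) ℂ[Δ_m(f)]` whenever `μ` occurs
  in `ℂ[Δ_m(f)]` (`orbitMultiplicity_le_add_of_hasHighestWeight`): multiplication by a nonzero
  highest-weight vector of weight `μ` is an injective linear map of highest-weight spaces, because
  `ℂ[Δ_m(f)]` is an integral domain (`isDomain_orbitCoordRing`) and highest-weight vectors multiply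
  (`mul_mem_highestWeightSpace_orbitCoordRep`); the target is finite-dimensional (a weight pins the
  degree, `finiteDimensional_highestWeightSpace_orbitCoordRep_holds`).
* §2 the two sides of the item: the padded-permanent multiplicity `mult_pp` is monotone along the
  weights occurring in `ℂ[Δ(X₀₀^(m-n) per_n)]`, the determinant multiplicity `K_m` along those
  occurring in `ℂ[Δ(det_m)]`, and — by BIP's no-occurrence theorem as discharged in the tree
  (`no_occurrence_obstructions_holds`, `n ^ 25 ≤ m`) — `K_m` is monotone along the padded-permanent
  occurrence semigroup as well (`orbitMultiplicity_det_le_add_of_paddedPer_pos`).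
* §3 the valuative truncations form a graded algebra without zero divisors inside `ℂ[End W]`:
  `T_U(d, t, χ) · T_U(d', t', χ') ⊆ T_U(d + d', t + t', χ + χ')` (degrees, vanishing orders along
  `L_U` and weights add; `Stab(det_m)`-invariance is multiplicative), hence
  `dim T_U(d, t, χ) ≤ dim T_U(d + d', t + t', χ + χ')` as soon as `T_U(d', t', χ') ≠ 0`
  (`finrank_valTruncation_le_add`); in the item's currency (`T_U(λ) = T_U(mδ, δ(m-r), λ*)`), the
  right-hand side `dim T_U` of `NoValuativeFlip` is monotone under `λ* ↦ λ* + μ*` for every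
  `μ ⊢ mδ'` with `K_m(μ*) > 0` (`finrank_truncation_le_add_of_orbitMultiplicity_det_pos`, using the
  route's valuative bound `K_m(μ*) ≤ dim T_U(μ)`, stmt-12625), in particular — at `n ^ 25 ≤ m` —
  for every `μ*` occurring on the permanent side.

So at paddings `m ≥ n ^ 25` the defect `dim T_U(λ) - mult_pp(λ*)` of the item compares two
functions that are both monotone along the padded-permanent occurrence semigroup; a valuative flip,
if any, is not inherited upward or downward along the semigroup by these laws alone (the open
content is untouched). Elementary given the tree; no new facts.

Sources: P. Bürgisser, C. Ikenmeyer, G. Panova, J. AMS 32 (2019) Lemma 2.2 and Thm. 1.4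
(arXiv:1604.06431); BLMW, SIAM J. Comput. 40 (2011) §5.2 (arXiv:0907.2850); M. Bläser,
C. Ikenmeyer, Theory of Computing Graduate Surveys 10 (2025) §12.4.
-/

-- `Summit.ValiantsHypothesis.ValiantsHypothesis.…` repeats a component by the D-0017 layout
-- (single-conjunct summit), which the `dupNamespace` linter flags; the name is mandated.
set_option linter.dupNamespace false

namespace Summit.ValiantsHypothesis.ValiantsHypothesis.Theorems.NoValuativeFlip

open Literature.NumberTheory.DiophantineGeometry Literature.Computability.AlgebraicComplexity
open Literature.Computability.Complexity
open Summit.ValiantsHypothesis.ValiantsHypothesis.Theses.ValuativeGCT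
open Summit.ValiantsHypothesis.ValiantsHypothesis.Theorems.ValuativeBound

/-! ## §1 The quantitative semigroup property of orbit-closure multiplicities -/

/-- **Multiplicities in `ℂ[Δ_m(f)]` are monotone along occurring weights.** For a form `f`,
`m ≠ 0` and weights `χ`, `μ` with `μ` occurring in the coordinate ring of the orbit closure
(`HasHighestWeight (orbitCoordRep f m) μ`): `mult_χ ≤ mult_(χ+μ)`. Multiplication by a nonzero
highest-weight vector `y` of weight `μ` maps highest-weight vectors of weight `χ` to highest-weight
vectors of weight `χ + μ` (`mul_mem_highestWeightSpace_orbitCoordRep`), injectively since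
`ℂ[Δ_m(f)]` is a domain (`isDomain_orbitCoordRing`); the target space is finite-dimensional
(`finiteDimensional_highestWeightSpace_orbitCoordRep_holds`). The occurrence shadow is BIP 2019
Lemma 2.2. [Bürgisser–Ikenmeyer–Panova 2019, Lemma 2.2 (proof)] -/
theorem orbitMultiplicity_le_add_of_hasHighestWeight {σ : Type*} [Fintype σ] [LinearOrder σ]
    (f : MvPolynomial σ ℂ) {m : ℕ} (hm : m ≠ 0) (χ μ : Weight σ)
    (hμ : HasHighestWeight (orbitCoordRep f m) μ) :
    orbitMultiplicity ℂ f m χ ≤ orbitMultiplicity ℂ f m (χ + μ) := by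
  classical
  rw [hasHighestWeight_iff_exists] at hμ
  obtain ⟨y, hy0, hy⟩ := hμ
  haveI : IsDomain (OrbitCoordRing f m) := isDomain_orbitCoordRing f m
  haveI : FiniteDimensional ℂ (highestWeightSpace (orbitCoordRep f m) (χ + μ)) :=
    finiteDimensional_highestWeightSpace_orbitCoordRep_holds f hm (χ + μ)
  let L : highestWeightSpace (orbitCoordRep f m) χ →ₗ[ℂ]
      highestWeightSpace (orbitCoordRep f m) (χ + μ) :=
    { toFun := fun x => ⟨x.1 * y, mul_mem_highestWeightSpace_orbitCoordRep f m x.2 hy⟩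
      map_add' := fun a b => by
        ext
        simp [add_mul]
      map_smul' := fun c a => by
        ext
        simp [smul_mul_assoc] }
  have hL : Function.Injective L := by
    intro a b hab
    have h1 : a.1 * y = b.1 * y := congrArg Subtype.val hab
    exact Subtype.ext (mul_right_cancel₀ hy0 h1)
  exact LinearMap.finrank_le_finrank_of_injective hL

/-- The same with the occurring weight added on the left: `mult_χ ≤ mult_(μ+χ)`. -/
theorem orbitMultiplicity_le_add_of_hasHighestWeight' {σ : Type*} [Fintype σ] [LinearOrder σ]
    (f : MvPolynomial σ ℂ) {m : ℕ} (hm : m ≠ 0) (χ μ : Weight σ)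
    (hμ : HasHighestWeight (orbitCoordRep f m) μ) :
    orbitMultiplicity ℂ f m χ ≤ orbitMultiplicity ℂ f m (μ + χ) := by
  rw [add_comm]
  exact orbitMultiplicity_le_add_of_hasHighestWeight f hm χ μ hμ

/-- Positivity of the multiplicity is occurrence (the `finrank` of the zero submodule is `0`). -/
theorem hasHighestWeight_of_orbitMultiplicity_pos {σ : Type*} [Fintype σ] [LinearOrder σ]
    (f : MvPolynomial σ ℂ) {m : ℕ} {χ : Weight σ} (h : 0 < orbitMultiplicity ℂ f m χ) :
    HasHighestWeight (orbitCoordRep f m) χ := by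
  intro hbot
  have h0 : orbitMultiplicity ℂ f m χ = 0 := by
    rw [orbitMultiplicity, hwMultiplicity]
    change Module.finrank ℂ ↥(highestWeightSpace (orbitCoordRep f m) χ) = 0
    rw [hbot, finrank_bot]
  omega

/-- **Iterated form**: `mult_χ ≤ mult_(χ + k • μ)` for every `k`, whenever `μ` occurs. -/
theorem orbitMultiplicity_le_add_nsmul_of_hasHighestWeight {σ : Type*} [Fintype σ] [LinearOrder σ]
    (f : MvPolynomial σ ℂ) {m : ℕ} (hm : m ≠ 0) (χ μ : Weight σ)
    (hμ : HasHighestWeight (orbitCoordRep f m) μ) (k : ℕ) :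
    orbitMultiplicity ℂ f m χ ≤ orbitMultiplicity ℂ f m (χ + k • μ) := by
  induction k with
  | zero => simp
  | succ k ih =>
    refine ih.trans ?_
    have h := orbitMultiplicity_le_add_of_hasHighestWeight f hm (χ + k • μ) μ hμ
    rwa [add_assoc, ← succ_nsmul] at h

/-! ## §2 The two sides of the item -/

/-- **The permanent side is monotone along its occurrence semigroup**: for weights `χ`, `μ` of
`GL_{m²}` with `μ` occurring in `ℂ[Δ(X₀₀^(m-n) per_n)]` (positive multiplicity),
`mult_pp(χ) ≤ mult_pp(χ + μ)`. -/
theorem orbitMultiplicity_paddedPer_le_add {n m : ℕ} [NeZero m] (χ μ : Weight (MatIdx m))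
    (hμ : 0 < orbitMultiplicity ℂ (paddedPerFormLex ℂ n m) m μ) :
    orbitMultiplicity ℂ (paddedPerFormLex ℂ n m) m χ ≤
      orbitMultiplicity ℂ (paddedPerFormLex ℂ n m) m (χ + μ) :=
  orbitMultiplicity_le_add_of_hasHighestWeight _ (NeZero.ne m) χ μ
    (hasHighestWeight_of_orbitMultiplicity_pos _ hμ)

/-- **The determinant side is monotone along its occurrence semigroup**: for weights `χ`, `μ`
with `K_m(μ) > 0`, `K_m(χ) ≤ K_m(χ + μ)` (`K_m` = multiplicity in `ℂ[Δ(det_m)]`). -/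
theorem orbitMultiplicity_det_le_add {m : ℕ} [NeZero m] (χ μ : Weight (MatIdx m))
    (hμ : 0 < orbitMultiplicity ℂ (detFormLex ℂ m) m μ) :
    orbitMultiplicity ℂ (detFormLex ℂ m) m χ ≤ orbitMultiplicity ℂ (detFormLex ℂ m) m (χ + μ) :=
  orbitMultiplicity_le_add_of_hasHighestWeight _ (NeZero.ne m) χ μ
    (hasHighestWeight_of_orbitMultiplicity_pos _ hμ)

/-- **`K_m` is monotone along the padded-permanent occurrence semigroup at `m ≥ n ^ 25`**: for
`0 < n`, `n ^ 25 ≤ m` and `μ` with `mult_pp(μ) > 0`, `K_m(χ) ≤ K_m(χ + μ)` for every `χ` — BIP's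
no-occurrence theorem (tree: `no_occurrence_obstructions_holds`, via
`orbitMultiplicity_det_pos_of_paddedPer_pos`) moves the occurrence of `μ` to the determinant, then
`orbitMultiplicity_det_le_add`. [Bürgisser–Ikenmeyer–Panova 2019, Thm. 1.4 and Lemma 2.2] -/
theorem orbitMultiplicity_det_le_add_of_paddedPer_pos {n m : ℕ} [NeZero m] (hn : 0 < n)
    (hnm : n ^ 25 ≤ m) (χ μ : Weight (MatIdx m))
    (hμ : 0 < orbitMultiplicity ℂ (paddedPerFormLex ℂ n m) m μ) :
    orbitMultiplicity ℂ (detFormLex ℂ m) m χ ≤ orbitMultiplicity ℂ (detFormLex ℂ m) m (χ + μ) :=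
  orbitMultiplicity_det_le_add χ μ (orbitMultiplicity_det_pos_of_paddedPer_pos hn hnm μ hμ)

/-! ## §3 The valuative truncations multiply -/

/-- **Products of truncation elements.** In `ℂ[End W]` (variables `A j i`), if `G` is homogeneous
of degree `d`, lies in `P_U^t` (`P_U` the vanishing ideal of `L_U = {A : every row in U}`), is
invariant under `A ↦ A M` for every `M` in the `End`-stabiliser of `det_m`, and is a `B`-semi-
invariant of weight `χ` for the upper triangular Borel acting by `A ↦ g⁻¹ A`, and `G'` is the same
with `(d', t', χ')`, then `G G'` is the same with `(d + d', t + t', χ + χ')`: degrees and vanishing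
orders add (`IsHomogeneous.mul`, `Ideal.mul_mem_mul`), the substitutions are algebra maps, and
weight characters are additive in the weight (`weightChar_add`). [folklore] -/
theorem valTruncation_mul_mem {m : ℕ} (U : Submodule ℂ (MatIdx m → ℂ)) {d d' t t' : ℕ}
    {χ χ' : Weight (MatIdx m)} {G G' : MvPolynomial (MatIdx m × MatIdx m) ℂ}
    (hG : G ∈ MvPolynomial.homogeneousSubmodule (MatIdx m × MatIdx m) ℂ d ⊓ ((MvPolynomial.vanishingIdeal ℂ {p : MatIdx m × MatIdx m → ℂ | ∀ j : MatIdx m, (fun i => p (j, i)) ∈ U}) ^ t).restrictScalars ℂ ⊓ (⨅ (M : Matrix (MatIdx m) (MatIdx m) ℂ) (_ : linSubst (MatIdx m) ℂ M (detFormLex ℂ m) = detFormLex ℂ m), LinearMap.ker ((MvPolynomial.aeval (R := ℂ) fun p : MatIdx m × MatIdx m => ∑ l : MatIdx m, M l p.2 • MvPolynomial.X (p.1, l)).toLinearMap - LinearMap.id (R := ℂ) (M := MvPolynomial (MatIdx m × MatIdx m) ℂ))) ⊓ (⨅ (g : Matrix.GeneralLinearGroup (MatIdx m) ℂ) (_ :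 IsUpperTriangular g), LinearMap.ker ((MvPolynomial.aeval (R := ℂ) fun p : MatIdx m × MatIdx m => ∑ l : MatIdx m, ((g⁻¹ : Matrix.GeneralLinearGroup (MatIdx m) ℂ) : Matrix (MatIdx m) (MatIdx m) ℂ) p.1 l • MvPolynomial.X (l, p.2)).toLinearMap - weightChar χ g • LinearMap.id (R := ℂ) (M := MvPolynomial (MatIdx m × MatIdx m) ℂ))))
    (hG' : G' ∈ MvPolynomial.homogeneousSubmodule (MatIdx m × MatIdx m) ℂ d' ⊓ ((MvPolynomial.vanishingIdeal ℂ {p : MatIdx m × MatIdx m → ℂ | ∀ j : MatIdx m, (fun i => p (j, i)) ∈ U}) ^ t').restrictScalars ℂ ⊓ (⨅ (M : Matrix (MatIdx m) (MatIdx m) ℂ) (_ : linSubst (MatIdx m) ℂ M (detFormLex ℂ m) = detFormLex ℂ m), LinearMap.ker ((MvPolynomial.aeval (R := ℂ) fun p : MatIdx m × MatIdx m => ∑ l : MatIdx m, M l p.2 • MvPolynomial.X (p.1, l)).toLinearMap - LinearMap.id (R := ℂ) (M := MvPolynomial (MatIdx m × MatIdx m) ℂ))) ⊓ (⨅ (g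 : Matrix.GeneralLinearGroup (MatIdx m) ℂ) (_ : IsUpperTriangular g), LinearMap.ker ((MvPolynomial.aeval (R := ℂ) fun p : MatIdx m × MatIdx m => ∑ l : MatIdx m, ((g⁻¹ : Matrix.GeneralLinearGroup (MatIdx m) ℂ) : Matrix (MatIdx m) (MatIdx m) ℂ) p.1 l • MvPolynomial.X (l, p.2)).toLinearMap - weightChar χ' g • LinearMap.id (R := ℂ) (M := MvPolynomial (MatIdx m × MatIdx m) ℂ)))) :
    G * G' ∈ MvPolynomial.homogeneousSubmodule (MatIdx m × MatIdx m) ℂ (d + d') ⊓ ((MvPolynomial.vanishingIdeal ℂ {p : MatIdx m × MatIdx m → ℂ | ∀ j : MatIdx m, (fun i => p (j, i)) ∈ U}) ^ (t + t')).restrictScalars ℂ ⊓ (⨅ (M : Matrix (MatIdx m) (MatIdx m) ℂ) (_ : linSubst (MatIdx m) ℂ M (detFormLex ℂ m) = detFormLex ℂ m), LinearMap.ker ((MvPolynomial.aeval (R := ℂ) fun p : MatIdx m × MatIdx m => ∑ l : MatIdx m, M l p.2 • MvPolynomial.X (p.1, l)).toLinearMap - LinearMap.id (R := ℂ) (M :=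 MvPolynomial (MatIdx m × MatIdx m) ℂ))) ⊓ (⨅ (g : Matrix.GeneralLinearGroup (MatIdx m) ℂ) (_ : IsUpperTriangular g), LinearMap.ker ((MvPolynomial.aeval (R := ℂ) fun p : MatIdx m × MatIdx m => ∑ l : MatIdx m, ((g⁻¹ : Matrix.GeneralLinearGroup (MatIdx m) ℂ) : Matrix (MatIdx m) (MatIdx m) ℂ) p.1 l • MvPolynomial.X (l, p.2)).toLinearMap - weightChar (χ + χ') g • LinearMap.id (R := ℂ) (M := MvPolynomial (MatIdx m × MatIdx m) ℂ))) := by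
  simp only [Submodule.mem_inf, Submodule.mem_iInf, LinearMap.mem_ker, LinearMap.sub_apply,
    LinearMap.id_apply, AlgHom.toLinearMap_apply, LinearMap.smul_apply, sub_eq_zero,
    Submodule.restrictScalars_mem, MvPolynomial.mem_homogeneousSubmodule] at hG hG' ⊢
  obtain ⟨⟨⟨hG1, hG2⟩, hG3⟩, hG4⟩ := hG
  obtain ⟨⟨⟨hG1', hG2'⟩, hG3'⟩, hG4'⟩ := hG'
  refine ⟨⟨⟨hG1.mul hG1', ?_⟩, fun M hM => ?_⟩, fun g hg => ?_⟩
  · rw [pow_add]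
    exact Ideal.mul_mem_mul hG2 hG2'
  · rw [map_mul, hG3 M hM, hG3' M hM]
  · rw [map_mul, hG4 g hg, hG4' g hg, weightChar_add χ χ' hg, smul_mul_smul_comm]

/-- **The truncation dimension is monotone along nonzero truncations.** With the notation of
`valTruncation_mul_mem`: if the `(d', t', χ')`-truncation is nonzero then
`dim T_U(d, t, χ) ≤ dim T_U(d + d', t + t', χ + χ')` — multiplication by a nonzero element of the
former is an injective linear map (`ℂ[End W]` is a domain), and the target sits in the
finite-dimensional degree piece `ℂ[End W]_(d+d')`. [folklore] -/
theorem finrank_valTruncation_le_add {m : ℕ} (U : Submodule ℂ (MatIdx m → ℂ)) (d d' t t' : ℕ)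
    (χ χ' : Weight (MatIdx m))
    (hne : MvPolynomial.homogeneousSubmodule (MatIdx m × MatIdx m) ℂ d' ⊓ ((MvPolynomial.vanishingIdeal ℂ {p : MatIdx m × MatIdx m → ℂ | ∀ j : MatIdx m, (fun i => p (j, i)) ∈ U}) ^ t').restrictScalars ℂ ⊓ (⨅ (M : Matrix (MatIdx m) (MatIdx m) ℂ) (_ : linSubst (MatIdx m) ℂ M (detFormLex ℂ m) = detFormLex ℂ m), LinearMap.ker ((MvPolynomial.aeval (R := ℂ) fun p : MatIdx m × MatIdx m => ∑ l : MatIdx m, M l p.2 • MvPolynomial.X (p.1, l)).toLinearMap - LinearMap.id (R := ℂ) (M := MvPolynomial (MatIdx m × MatIdx m) ℂ))) ⊓ (⨅ (g : Matrix.GeneralLinearGroup (MatIdx m) ℂ) (_ : IsUpperTriangular g), LinearMap.ker ((MvPolynomial.aeval (R := ℂ) fun p : MatIdx m × MatIdx m => ∑ l : MatIdx m, ((g⁻¹ : Matrix.GeneralLinearGroup (MatIdx m) ℂ) : Matrix (MatIdx m) (MatIdx m) ℂ) p.1 l • MvPolynomial.X (l, p.2)).toLinearMap - weightChar χ' g •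 LinearMap.id (R := ℂ) (M := MvPolynomial (MatIdx m × MatIdx m) ℂ))) ≠ ⊥) :
    Module.finrank ℂ ↥(MvPolynomial.homogeneousSubmodule (MatIdx m × MatIdx m) ℂ d ⊓ ((MvPolynomial.vanishingIdeal ℂ {p : MatIdx m × MatIdx m → ℂ | ∀ j : MatIdx m, (fun i => p (j, i)) ∈ U}) ^ t).restrictScalars ℂ ⊓ (⨅ (M : Matrix (MatIdx m) (MatIdx m) ℂ) (_ : linSubst (MatIdx m) ℂ M (detFormLex ℂ m) = detFormLex ℂ m), LinearMap.ker ((MvPolynomial.aeval (R := ℂ) fun p : MatIdx m × MatIdx m => ∑ l : MatIdx m, M l p.2 • MvPolynomial.X (p.1, l)).toLinearMap - LinearMap.id (R := ℂ) (M := MvPolynomial (MatIdx m × MatIdx m) ℂ))) ⊓ (⨅ (g : Matrix.GeneralLinearGroup (MatIdx m) ℂ) (_ : IsUpperTriangular g), LinearMap.ker ((MvPolynomial.aeval (R := ℂ) fun p : MatIdx m × MatIdx m => ∑ l : MatIdx m, ((g⁻¹ : Matrix.GeneralLinearGroup (MatIdx m) ℂ) : Matrix (MatIdx m) (MatIdx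 m) ℂ) p.1 l • MvPolynomial.X (l, p.2)).toLinearMap - weightChar χ g • LinearMap.id (R := ℂ) (M := MvPolynomial (MatIdx m × MatIdx m) ℂ)))) ≤
    Module.finrank ℂ ↥(MvPolynomial.homogeneousSubmodule (MatIdx m × MatIdx m) ℂ (d + d') ⊓ ((MvPolynomial.vanishingIdeal ℂ {p : MatIdx m × MatIdx m → ℂ | ∀ j : MatIdx m, (fun i => p (j, i)) ∈ U}) ^ (t + t')).restrictScalars ℂ ⊓ (⨅ (M : Matrix (MatIdx m) (MatIdx m) ℂ) (_ : linSubst (MatIdx m) ℂ M (detFormLex ℂ m) = detFormLex ℂ m), LinearMap.ker ((MvPolynomial.aeval (R := ℂ) fun p : MatIdx m × MatIdx m => ∑ l : MatIdx m, M l p.2 • MvPolynomial.X (p.1, l)).toLinearMap - LinearMap.id (R := ℂ) (M := MvPolynomial (MatIdx m × MatIdx m) ℂ))) ⊓ (⨅ (g : Matrix.GeneralLinearGroup (MatIdx m) ℂ) (_ : IsUpperTriangular g), LinearMap.ker ((MvPolynomial.aeval (R := ℂ) fun p : MatIdx m × MatIdx m => ∑ l : MatIdx m, ((g⁻¹ :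 Matrix.GeneralLinearGroup (MatIdx m) ℂ) : Matrix (MatIdx m) (MatIdx m) ℂ) p.1 l • MvPolynomial.X (l, p.2)).toLinearMap - weightChar (χ + χ') g • LinearMap.id (R := ℂ) (M := MvPolynomial (MatIdx m × MatIdx m) ℂ)))) := by
  classical
  obtain ⟨y, hy, hy0⟩ := (Submodule.ne_bot_iff _).mp hne
  haveI : Module.Finite ℂ ↥(MvPolynomial.homogeneousSubmodule (MatIdx m × MatIdx m) ℂ (d + d')) :=
    Module.Finite.iff_fg.mpr (MvPolynomial.homogeneousSubmodule_fg _ _ _)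
  haveI : Module.Finite ℂ ↥(MvPolynomial.homogeneousSubmodule (MatIdx m × MatIdx m) ℂ (d + d') ⊓ ((MvPolynomial.vanishingIdeal ℂ {p : MatIdx m × MatIdx m → ℂ | ∀ j : MatIdx m, (fun i => p (j, i)) ∈ U}) ^ (t + t')).restrictScalars ℂ ⊓ (⨅ (M : Matrix (MatIdx m) (MatIdx m) ℂ) (_ : linSubst (MatIdx m) ℂ M (detFormLex ℂ m) = detFormLex ℂ m), LinearMap.ker ((MvPolynomial.aeval (R := ℂ) fun p : MatIdx m × MatIdx m => ∑ l : MatIdx m, M l p.2 • MvPolynomial.X (p.1, l)).toLinearMap - LinearMap.id (R := ℂ) (M := MvPolynomial (MatIdx m × MatIdx m) ℂ))) ⊓ (⨅ (g : Matrix.GeneralLinearGroup (MatIdx m) ℂ) (_ : IsUpperTriangular g), LinearMap.ker ((MvPolynomial.aeval (R := ℂ) fun p : MatIdx m × MatIdx m => ∑ l : MatIdx m, ((g⁻¹ : Matrix.GeneralLinearGroup (MatIdx m) ℂ) : Matrix (MatIdx m) (MatIdx m) ℂ) p.1 l • MvPolynomial.X (l, p.2)).toLinearMap - weightChar (χ +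 χ') g • LinearMap.id (R := ℂ) (M := MvPolynomial (MatIdx m × MatIdx m) ℂ)))) :=
    Submodule.finiteDimensional_of_le (inf_le_left.trans (inf_le_left.trans inf_le_left))
  refine LinearMap.finrank_le_finrank_of_injective
    (f := { toFun := fun x => ⟨x.1 * y, valTruncation_mul_mem U x.2 hy⟩
            map_add' := fun a b => Subtype.ext (by
              change ((a : MvPolynomial (MatIdx m × MatIdx m) ℂ) + b) * y = a * y + b * y
              exact add_mul _ _ _)
            map_smul' := fun c a => Subtype.ext (by
              change (c • (a : MvPolynomial (MatIdx m × MatIdx m) ℂ)) * y = c • ((a : MvPolynomial (MatIdx m × MatIdx m) ℂ) * y)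
              exact smul_mul_assoc _ _ _) }) ?_
  intro a b hab
  have h1 : a.1 * y = b.1 * y := congrArg Subtype.val hab
  exact Subtype.ext (mul_right_cancel₀ hy0 h1)

/-- **The right-hand side of `NoValuativeFlip` is monotone along the determinant's occurrence
semigroup, at every centre.** For a centre `(U, r)` with rank `≤ r` on `U`, degrees `δ, δ'` and
partitions `λ ⊢ mδ`, `μ ⊢ mδ'` with at most `m²` parts: if `K_m(μ*) > 0` then
`dim T_U(λ) ≤ dim T_U(m(δ+δ'), (δ+δ')(m-r), λ* + μ*)`, the truncation at the summed data (which is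
`T_U(λ + μ)` for the row-wise sum, whose dual weight is `λ* + μ*`). The route's valuative bound
`K_m(μ*) ≤ dim T_U(μ)` (`ValuativeBound_proof`, stmt-12625) makes `T_U(μ)` nonzero, then
`finrank_valTruncation_le_add`. In particular (with `orbitMultiplicity_det_pos_of_paddedPer_pos`)
this holds at `n ^ 25 ≤ m` for every `μ*` occurring in `ℂ[Δ(X₀₀^(m-n) per_n)]`. [folklore] -/
theorem finrank_truncation_le_add_of_orbitMultiplicity_det_pos (m : ℕ) [NeZero m]
    (U : Submodule ℂ (Literature.NumberTheory.DiophantineGeometry.MatIdx m → ℂ)) (r : ℕ)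
    (hU : ∀ u ∈ U, (Matrix.of fun a b : Fin m => u (toLex (a, b))).rank ≤ r)
    (δ δ' : ℕ) (lam : Nat.Partition (m * δ)) (mu : Nat.Partition (m * δ'))
    (hmu : mu.parts.card ≤ m * m)
    (hpos : 0 < orbitMultiplicity ℂ (detFormLex ℂ m) m
      ((Weight.dualOfPartition (m * m) mu).toMatIdx : Weight (MatIdx m))) :
    let χ : Literature.NumberTheory.DiophantineGeometry.Weight (Literature.NumberTheory.DiophantineGeometry.MatIdx m) := (Literature.NumberTheory.DiophantineGeometry.Weight.dualOfPartition (m * m) lam).toMatIdx; let χ' : Literature.NumberTheory.DiophantineGeometry.Weight (Literature.NumberTheory.DiophantineGeometry.MatIdx m) := (Literature.NumberTheory.DiophantineGeometry.Weight.dualOfPartition (m * m) mu).toMatIdx; Module.finrank ℂ ↥(MvPolynomial.homogeneousSubmodule (Literature.NumberTheory.DiophantineGeometry.MatIdx m × Literature.NumberTheory.DiophantineGeometry.MatIdx m) ℂ (m * δ) ⊓ ((MvPolynomial.vanishingIdeal ℂ {p : Literature.NumberTheory.DiophantineGeometry.MatIdx m × Literature.NumberTheory.DiophantineGeometry.MatIdx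 m → ℂ | ∀ j : Literature.NumberTheory.DiophantineGeometry.MatIdx m, (fun i => p (j, i)) ∈ U}) ^ (δ * (m - r))).restrictScalars ℂ ⊓ (⨅ (M : Matrix (Literature.NumberTheory.DiophantineGeometry.MatIdx m) (Literature.NumberTheory.DiophantineGeometry.MatIdx m) ℂ) (_ : Literature.Computability.AlgebraicComplexity.linSubst (Literature.NumberTheory.DiophantineGeometry.MatIdx m) ℂ M (Literature.NumberTheory.DiophantineGeometry.detFormLex ℂ m) = Literature.NumberTheory.DiophantineGeometry.detFormLex ℂ m), LinearMap.ker ((MvPolynomial.aeval (R := ℂ) fun p : Literature.NumberTheory.DiophantineGeometry.MatIdx m × Literature.NumberTheory.DiophantineGeometry.MatIdx m => ∑ l : Literature.NumberTheory.DiophantineGeometry.MatIdx m, M l p.2 • MvPolynomial.X (p.1, l)).toLinearMap - LinearMap.id (R := ℂ) (M := MvPolynomial (Literature.NumberTheory.DiophantineGeometry.MatIdx m × Literature.NumberTheory.DiophantineGeometry.MatIdx m) ℂ))) ⊓ (⨅ (g : Matrix.GeneralLinearGroup (Literature.NumberTheory.DiophantineGeometry.MatIdx m) ℂ) (_ : Literature.NumberTheory.DiophantineGeometry.IsUpperTriangular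 g), LinearMap.ker ((MvPolynomial.aeval (R := ℂ) fun p : Literature.NumberTheory.DiophantineGeometry.MatIdx m × Literature.NumberTheory.DiophantineGeometry.MatIdx m => ∑ l : Literature.NumberTheory.DiophantineGeometry.MatIdx m, ((g⁻¹ : Matrix.GeneralLinearGroup (Literature.NumberTheory.DiophantineGeometry.MatIdx m) ℂ) : Matrix (Literature.NumberTheory.DiophantineGeometry.MatIdx m) (Literature.NumberTheory.DiophantineGeometry.MatIdx m) ℂ) p.1 l • MvPolynomial.X (l, p.2)).toLinearMap - Literature.NumberTheory.DiophantineGeometry.weightChar χ g • LinearMap.id (R := ℂ) (M := MvPolynomial (Literature.NumberTheory.DiophantineGeometry.MatIdx m × Literature.NumberTheory.DiophantineGeometry.MatIdx m) ℂ)))) ≤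
    Module.finrank ℂ ↥(MvPolynomial.homogeneousSubmodule (Literature.NumberTheory.DiophantineGeometry.MatIdx m × Literature.NumberTheory.DiophantineGeometry.MatIdx m) ℂ (m * (δ + δ')) ⊓ ((MvPolynomial.vanishingIdeal ℂ {p : Literature.NumberTheory.DiophantineGeometry.MatIdx m × Literature.NumberTheory.DiophantineGeometry.MatIdx m → ℂ | ∀ j : Literature.NumberTheory.DiophantineGeometry.MatIdx m, (fun i => p (j, i)) ∈ U}) ^ ((δ + δ') * (m - r))).restrictScalars ℂ ⊓ (⨅ (M : Matrix (Literature.NumberTheory.DiophantineGeometry.MatIdx m) (Literature.NumberTheory.DiophantineGeometry.MatIdx m) ℂ) (_ : Literature.Computability.AlgebraicComplexity.linSubst (Literature.NumberTheory.DiophantineGeometry.MatIdx m) ℂ M (Literature.NumberTheory.DiophantineGeometry.detFormLex ℂ m) = Literature.NumberTheory.DiophantineGeometry.detFormLex ℂ m), LinearMap.ker ((MvPolynomial.aeval (R := ℂ) fun p : Literature.NumberTheory.DiophantineGeometry.MatIdx m × Literature.NumberTheory.DiophantineGeometry.MatIdx m => ∑ l : Literature.NumberTheory.DiophantineGeometry.MatIdx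 m, M l p.2 • MvPolynomial.X (p.1, l)).toLinearMap - LinearMap.id (R := ℂ) (M := MvPolynomial (Literature.NumberTheory.DiophantineGeometry.MatIdx m × Literature.NumberTheory.DiophantineGeometry.MatIdx m) ℂ))) ⊓ (⨅ (g : Matrix.GeneralLinearGroup (Literature.NumberTheory.DiophantineGeometry.MatIdx m) ℂ) (_ : Literature.NumberTheory.DiophantineGeometry.IsUpperTriangular g), LinearMap.ker ((MvPolynomial.aeval (R := ℂ) fun p : Literature.NumberTheory.DiophantineGeometry.MatIdx m × Literature.NumberTheory.DiophantineGeometry.MatIdx m => ∑ l : Literature.NumberTheory.DiophantineGeometry.MatIdx m, ((g⁻¹ : Matrix.GeneralLinearGroup (Literature.NumberTheory.DiophantineGeometry.MatIdx m) ℂ) : Matrix (Literature.NumberTheory.DiophantineGeometry.MatIdx m) (Literature.NumberTheory.DiophantineGeometry.MatIdx m) ℂ) p.1 l • MvPolynomial.X (l, p.2)).toLinearMap - Literature.NumberTheory.DiophantineGeometry.weightChar (χ + χ') g • LinearMap.id (R := ℂ) (M := MvPolynomial (Literature.NumberTheory.DiophantineGeometry.MatIdx m × Literature.NumberTheory.DiophantineGeometry.MatIdx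 m) ℂ)))) := by
  intro χ χ'
  have hne : MvPolynomial.homogeneousSubmodule (MatIdx m × MatIdx m) ℂ (m * δ') ⊓ ((MvPolynomial.vanishingIdeal ℂ {p : MatIdx m × MatIdx m → ℂ | ∀ j : MatIdx m, (fun i => p (j, i)) ∈ U}) ^ (δ' * (m - r))).restrictScalars ℂ ⊓ (⨅ (M : Matrix (MatIdx m) (MatIdx m) ℂ) (_ : linSubst (MatIdx m) ℂ M (detFormLex ℂ m) = detFormLex ℂ m), LinearMap.ker ((MvPolynomial.aeval (R := ℂ) fun p : MatIdx m × MatIdx m => ∑ l : MatIdx m, M l p.2 • MvPolynomial.X (p.1, l)).toLinearMap - LinearMap.id (R := ℂ) (M := MvPolynomial (MatIdx m × MatIdx m) ℂ))) ⊓ (⨅ (g : Matrix.GeneralLinearGroup (MatIdx m) ℂ) (_ : IsUpperTriangular g), LinearMap.ker ((MvPolynomial.aeval (R := ℂ) fun p : MatIdx m × MatIdx m => ∑ l : MatIdx m, ((g⁻¹ : Matrix.GeneralLinearGroup (MatIdx m) ℂ) : Matrix (MatIdx m) (MatIdx m) ℂ) p.1 l • MvPolynomial.X (l, p.2)).toLinearMap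 - weightChar χ' g • LinearMap.id (R := ℂ) (M := MvPolynomial (MatIdx m × MatIdx m) ℂ))) ≠ ⊥ := by
    intro hbot
    have hle := ValuativeBound_proof m U r hU δ' mu hmu
    have h0 : orbitMultiplicity ℂ (detFormLex ℂ m) m χ' ≤ 0 := by
      refine hle.trans ?_
      rw [hbot, finrank_bot]
    exact absurd hpos (not_lt.mpr h0)
  have h := finrank_valTruncation_le_add U (m * δ) (m * δ') (δ * (m - r)) (δ' * (m - r)) χ χ' hne
  rwa [← mul_add, ← add_mul] at h

end Summit.ValiantsHypothesis.ValiantsHypothesis.Theorems.NoValuativeFlip
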